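import Summits.Ventures.CertifiedArithmetic.LowPrec.SRFewBitsGridBias
import Literature.ComputerArithmetic.FitzgibbonFelix2025.FewBitSR
import HarnessLib

/-!
# Few-bit stochastic rounding: the Fitzgibbon–Felix modes SRFF / SRF / SRC ARE the P3109 modes
# A / B / C, and their finite-precision bias facts — proved, completed and corrected
# (venture file LXIX of the SR slice)

HONEST FRAMING: certified error envelopes and provably optimal rounding/accumulation schemes for
low-precision formats under stated cost models; every table by two implementations; no hardware
or vendor claims.

Venture CertifiedArithmetic / lowprec, SR slice.  [FitzgibbonFelix2025] (typed verbatim in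
`Literature.ComputerArithmetic.FitzgibbonFelix2025`) defines few-bit SR by predicates on the
residual `δ̃` and the random word `n < 2^N`.  This file proves:
* the DICTIONARY, for every residual and every random word (no range hypothesis):
  `R_SRFF(δ̃,n) ⟺ StochasticA_{N,n}(δ̃)`, `R_SRF ⟺ StochasticB`, `R_SRC` with round-to-nearest-even
  pre-rounding `⟺ StochasticC` (`rsrff_iff_stochasticA`, `rsrf_iff_stochasticB`,
  `rsrc_rnite_iff_stochasticC`); and `R_SRC` with round-half-up pre-rounding (Mathlib's `round`,
  = ties-away on `[0,1)`) is LITERALLY `R_SRF` (`rsrc_round_iff_rsrf`) — so "Round is any unbiased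
  rounding scheme" in eq. (8) must exclude ties-away: that variant inherits SRF's grid bias;
* hence the paper's pointwise / grid bias functionals are the away-probabilities of file
  `SRLimitedBitsCounts` minus the residual (`pointBias_rsrff/rsrf/rsrc`, `gridBias_rsrff/rsrf/rsrc`);
* ALL the paper's bias facts DISCHARGED (net named-fact debt of the typing file: 0):
  §III-C/A-A `bias_SRFF = −2^{-(N+1)}` and §III-D/A-B `bias_SRF = 0` over real residuals
  (`SRFFContBias_holds`, `SRFContBias_holds`: each random word rounds away on an interval of
  length `n2^{-N}` resp. `(n+½)2^{-N}`); from file LXVIII (`SRFewBitsGridBias`): App. A-C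
  `bias_{SRFF,D} = (2^{-D} − 2^{-N})/2` for `N ≤ D` and `≤` always (`SRFFGridBias_holds`,
  `SRFFGridBiasLe_holds`); App. A-D `bias_{SRF,D} = 2^{-(D+1)}` for `N < D` and `≤` always
  (`SRFGridBias_holds`, `SRFGridBiasLe_holds`); §III-F SRC unbiased on every grid for `1 ≤ N ≤ D`
  (`SRCGridBias_holds`, `src_gridBias_eq_zero` over any field) — the paper asserts the last in words; it is a theorem here;
* what the paper does not state: for `D ≤ N` all three modes have grid bias EXACTLY `0`
  (`srff_gridBias_of_le`, `srf_gridBias_of_le`, `src_gridBias_of_le`); with `N = 0` random bits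
  SRC is round-to-nearest-even and its grid bias is `−2^{-(D+1)} ≠ 0` (`src_gridBias_zero_bits`),
  so `1 ≤ N` in §III-F is necessary; SRC∘ties-away has grid bias `+2^{-(D+1)}` for `N < D`
  (`srcRound_gridBias`).
Per-input (pointwise) laws, which are strictly stronger than these averages, are files
`SRLimitedBitsCounts` / `SRLimitedBits` / `SRLimitedBitsOptimal`.  No claim about any implementation.
-/

namespace Summit.Ventures.CertifiedArithmetic.LowPrec.SR.LimitedBits

open Literature.ComputerArithmetic.P3109
open Literature.ComputerArithmetic.FitzgibbonFelix2025
open Finset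

variable {K : Type*} [Field K] [LinearOrder K] [IsStrictOrderedRing K] [FloorRing K]

/-! ### Dictionary with the P3109 stochastic modes -/

/-- **SRFF = StochasticA**: `δ̃ + n 2^{-N} ≥ 1 ⟺ ⌊δ̃ 2^N⌋ + n ≥ 2^N`, for every `δ̃` and `n`. -/
theorem rsrff_iff_stochasticA (N n : ℕ) (δ : K) : RSRFF N δ n ↔ StochasticA N n δ := by
  unfold RSRFF StochasticA
  have h2 : (0 : K) < 2 ^ N := by positivity
  rw [show δ + (n : K) / 2 ^ N = (δ * 2 ^ N + n) / 2 ^ N by field_simp, le_div_iff₀ h2, one_mul,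
    show ((2 : ℤ) ^ N ≤ ⌊δ * 2 ^ N⌋ + n) ↔ ((2 : ℤ) ^ N - n ≤ ⌊δ * 2 ^ N⌋) from
      ⟨fun h => by linarith, fun h => by linarith⟩, Int.le_floor]
  push_cast
  constructor <;> intro h <;> linarith

/-- **SRF = StochasticB**: `δ̃ + (n + ½) 2^{-N} ≥ 1 ⟺ ⌊δ̃ 2^{N+1}⌋ + 2n + 1 ≥ 2^{N+1}`. -/
theorem rsrf_iff_stochasticB (N n : ℕ) (δ : K) : RSRF N δ n ↔ StochasticB N n δ := by
  unfold RSRF StochasticB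
  have h2 : (0 : K) < 2 ^ (N + 1) := by positivity
  rw [show δ + ((n : K) + 1 / 2) / 2 ^ N = (δ * 2 ^ (N + 1) + (2 * n + 1)) / 2 ^ (N + 1) by
      rw [pow_succ]; field_simp, le_div_iff₀ h2, one_mul,
    show ((2 : ℤ) ^ (N + 1) ≤ ⌊δ * 2 ^ (N + 1)⌋ + (2 * n + 1)) ↔
      ((2 : ℤ) ^ (N + 1) - (2 * n + 1) ≤ ⌊δ * 2 ^ (N + 1)⌋) from
      ⟨fun h => by linarith, fun h => by linarith⟩, Int.le_floor]
  push_cast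
  constructor <;> intro h <;> linarith

omit [FloorRing K] in
/-- SRFF applied to an `N`-bit integer count `r`: `r 2^{-N} + n 2^{-N} ≥ 1 ⟺ r + n ≥ 2^N`. -/
theorem rsrff_intCast_div_iff (N n : ℕ) (r : ℤ) :
    RSRFF N ((r : K) / 2 ^ N) n ↔ (2 : ℤ) ^ N ≤ r + n := by
  unfold RSRFF
  have h2 : (0 : K) < 2 ^ N := by positivity
  rw [show (r : K) / 2 ^ N + (n : K) / 2 ^ N = (r + n) / 2 ^ N by field_simp, le_div_iff₀ h2,
    one_mul, ← Int.cast_le (R := K)]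
  push_cast
  exact Iff.rfl

/-- **SRC with round-to-nearest-even = StochasticC**: `R_SRFF(RNE(δ̃ 2^N) 2^{-N}, n) ⟺
RNITE(δ̃ 2^N) + n ≥ 2^N`. -/
theorem rsrc_rnite_iff_stochasticC (N n : ℕ) (δ : K) :
    RSRC (fun y => rnite y) N δ n ↔ StochasticC N n δ := by
  unfold RSRC StochasticC
  exact rsrff_intCast_div_iff N n _

/-- **SRC with round-half-up (`round`, ties away on `[0, ∞)`) is literally SRF**:
`⌊δ̃ 2^N + ½⌋ + n ≥ 2^N ⟺ δ̃ + (n + ½) 2^{-N} ≥ 1`, for every `δ̃` and `n`. -/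
theorem rsrc_round_iff_rsrf (N n : ℕ) (δ : K) : RSRC round N δ n ↔ RSRF N δ n := by
  unfold RSRC
  rw [rsrff_intCast_div_iff, round_eq]
  unfold RSRF
  have h2 : (0 : K) < 2 ^ N := by positivity
  rw [show δ + ((n : K) + 1 / 2) / 2 ^ N = (δ * 2 ^ N + 1 / 2 + n) / 2 ^ N by field_simp; ring,
    le_div_iff₀ h2, one_mul,
    show ((2 : ℤ) ^ N ≤ ⌊δ * 2 ^ N + 1 / 2⌋ + n) ↔ ((2 : ℤ) ^ N - n ≤ ⌊δ * 2 ^ N + 1 / 2⌋) from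
      ⟨fun h => by linarith, fun h => by linarith⟩, Int.le_floor]
  push_cast
  constructor <;> intro h <;> linarith

/-! ### The paper's bias functionals are the away-probabilities minus the residual -/

omit [LinearOrder K] [IsStrictOrderedRing K] [FloorRing K] in
/-- A predicate agreeing with a P3109 mode has pointwise bias `awayCount/2^N − x`. -/
theorem pointBias_eq_awayCount (mode : ℕ → ℕ → K → Prop) [∀ N R η, Decidable (mode N R η)]
    (R : K → ℕ → Prop) [∀ x n, Decidable (R x n)] {N : ℕ} (hR : ∀ x n, R x n ↔ mode N n x)
    (x : K) : pointBias R N x = (awayCount mode N x : K) / 2 ^ N - x := by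
  unfold pointBias awayCount
  rw [natCast_card_filter]
  congr 1; congr 1
  exact sum_congr rfl (fun n _ => if_congr (hR x n) rfl rfl)

/-- `bias_SRFF(x) = P_A(x) − x` for `0 ≤ x < 1`. -/
theorem pointBias_rsrff {N : ℕ} {x : K} (h0 : 0 ≤ x) (h1 : x < 1) :
    pointBias (RSRFF N) N x = probAwayA N x - x := by
  rw [pointBias_eq_awayCount StochasticA (RSRFF N) (fun x n => rsrff_iff_stochasticA N n x),
    awayCount_stochasticA_div h0 h1]

/-- `bias_SRF(x) = P_B(x) − x` for `0 ≤ x < 1`. -/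
theorem pointBias_rsrf {N : ℕ} {x : K} (h0 : 0 ≤ x) (h1 : x < 1) :
    pointBias (RSRF N) N x = probAwayB N x - x := by
  rw [pointBias_eq_awayCount StochasticB (RSRF N) (fun x n => rsrf_iff_stochasticB N n x),
    awayCount_stochasticB_div h0 h1]

/-- `bias_SRC(x) = P_C(x) − x` for `0 ≤ x < 1` (round-to-nearest-even pre-rounding). -/
theorem pointBias_rsrc {N : ℕ} {x : K} (h0 : 0 ≤ x) (h1 : x < 1) :
    pointBias (RSRC (fun y => rnite y) N) N x = probAwayC N x - x := by
  rw [pointBias_eq_awayCount StochasticC (RSRC (fun y => rnite y) N)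
    (fun x n => rsrc_rnite_iff_stochasticC N n x), awayCount_stochasticC_div h0 h1]

omit [FloorRing K] in
/-- Grid residuals lie in `[0, 1)`. -/
theorem grid_mem {D i : ℕ} (hi : i ∈ range (2 ^ D)) :
    0 ≤ (i : K) / 2 ^ D ∧ (i : K) / 2 ^ D < 1 := by
  have h2 : (0 : K) < 2 ^ D := by positivity
  refine ⟨by positivity, ?_⟩
  rw [div_lt_one h2]
  exact_mod_cast mem_range.1 hi

/-- `bias_{SRFF,D}` is the grid average of `P_A − x`. -/
theorem gridBias_rsrff (N D : ℕ) : gridBias (RSRFF (K := K) N) N D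
    = (∑ i ∈ range (2 ^ D), (probAwayA N ((i : K) / 2 ^ D) - (i : K) / 2 ^ D)) / 2 ^ D := by
  unfold gridBias
  rw [sum_congr rfl (fun i hi => pointBias_rsrff (grid_mem hi).1 (grid_mem hi).2)]

/-- `bias_{SRF,D}` is the grid average of `P_B − x`. -/
theorem gridBias_rsrf (N D : ℕ) : gridBias (RSRF (K := K) N) N D
    = (∑ i ∈ range (2 ^ D), (probAwayB N ((i : K) / 2 ^ D) - (i : K) / 2 ^ D)) / 2 ^ D := by
  unfold gridBias
  rw [sum_congr rfl (fun i hi => pointBias_rsrf (grid_mem hi).1 (grid_mem hi).2)]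

/-- `bias_{SRC,D}` (RNE pre-rounding) is the grid average of `P_C − x`. -/
theorem gridBias_rsrc (N D : ℕ) : gridBias (RSRC (K := K) (fun y => rnite y) N) N D
    = (∑ i ∈ range (2 ^ D), (probAwayC N ((i : K) / 2 ^ D) - (i : K) / 2 ^ D)) / 2 ^ D := by
  unfold gridBias
  rw [sum_congr rfl (fun i hi => pointBias_rsrc (grid_mem hi).1 (grid_mem hi).2)]

/-- `bias_{SRC∘round,D} = bias_{SRF,D}`. -/
theorem gridBias_rsrc_round (N D : ℕ) :
    gridBias (RSRC (K := K) round N) N D = gridBias (RSRF (K := K) N) N D := by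
  unfold gridBias pointBias
  simp_rw [rsrc_round_iff_rsrf]

/-! ### The facts of [FitzgibbonFelix2025] §III-E/F and App. A-C/A-D, discharged -/

/-- **App. A-C (exact form)** (DISCHARGED): `bias_{SRFF,D} = (2^{-D} − 2^{-N})/2` for `N ≤ D`. -/
theorem SRFFGridBias_holds : SRFFGridBias := fun N D h => by
  rw [gridBias_rsrff]; exact gridAvg_probAwayA h

/-- **App. A-C (one-sided form)** (DISCHARGED): `bias_{SRFF,D} ≤ (2^{-D} − 2^{-N})/2`, all `N, D`. -/
theorem SRFFGridBiasLe_holds : SRFFGridBiasLe := fun N D => by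
  rw [gridBias_rsrff]; exact gridAvg_probAwayA_le N D

/-- **App. A-D (exact form)** (DISCHARGED): `bias_{SRF,D} = 2^{-(D+1)}` for `N < D`. -/
theorem SRFGridBias_holds : SRFGridBias := fun N D h => by
  rw [gridBias_rsrf]; exact gridAvg_probAwayB h

/-- **App. A-D (one-sided form)** (DISCHARGED): `bias_{SRF,D} ≤ 2^{-(D+1)}`, all `N, D`. -/
theorem SRFGridBiasLe_holds : SRFGridBiasLe := fun N D => by
  rw [gridBias_rsrf]; exact gridAvg_probAwayB_le N D

/-- **§III-F** over any field, and WITHOUT the paper's restriction `N ≤ D`: SRC with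
round-to-nearest-even pre-rounding is unbiased on average over every input grid `2^{-D}ℤ ∩ [0,1)`,
for every `D`, as soon as `N ≥ 1` (for `D ≤ N` the pre-rounding is exact and SRC = SRFF). -/
theorem src_gridBias_eq_zero {N : ℕ} (D : ℕ) (h1 : 1 ≤ N) :
    gridBias (RSRC (K := K) (fun y => rnite y) N) N D = 0 := by
  rw [gridBias_rsrc]
  rcases Nat.lt_or_ge N D with h | h
  · exact gridAvg_probAwayC h1 h
  · exact gridAvg_probAwayC_of_le h

/-- **§III-F** (DISCHARGED): the paper's SRC claim, with RNE pre-rounding and `1 ≤ N ≤ D`. -/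
theorem SRCGridBias_holds : SRCGridBias := fun _ D h1 _ => src_gridBias_eq_zero D h1

/-! ### The infinite-precision facts of §III-C/D (App. A-A/A-B), discharged -/

open MeasureTheory in
/-- `∫₀¹ 1[x + c ≥ 1] dx = c` for `0 ≤ c < 1` (the measure of `[1 − c, 1]`). -/
theorem integral_ite_one_le_add (c : ℝ) (h0 : 0 ≤ c) (h1 : c < 1) :
    ∫ x in (0 : ℝ)..1, (if 1 ≤ x + c then (1 : ℝ) else 0) = c := by
  have hind : (fun x : ℝ => if 1 ≤ x + c then (1 : ℝ) else 0)
      = Set.indicator (Set.Ici (1 - c)) (fun _ => (1 : ℝ)) := by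
    funext x
    simp only [Set.indicator, Set.mem_Ici, sub_le_iff_le_add]
  rw [intervalIntegral.integral_of_le zero_le_one, hind,
    setIntegral_indicator measurableSet_Ici, setIntegral_const, smul_eq_mul, mul_one]
  have : Set.Ioc (0 : ℝ) 1 ∩ Set.Ici (1 - c) = Set.Icc (1 - c) 1 := by
    ext x; simp only [Set.mem_inter_iff, Set.mem_Ioc, Set.mem_Ici, Set.mem_Icc]; constructor
    · rintro ⟨⟨-, hx1⟩, hx⟩; exact ⟨hx, hx1⟩
    · rintro ⟨hx, hx1⟩; exact ⟨⟨by linarith, hx1⟩, hx⟩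
  rw [this, Measure.real, Real.volume_Icc, ENNReal.toReal_ofReal (by linarith)]
  ring

/-- **§III-C / App. A-A** (DISCHARGED): over residuals uniform on `[0,1)`, `bias_SRFF = −2^{-(N+1)}`:
each random word `n` rounds away on `[1 − n2^{-N}, 1]`, of length `n 2^{-N}`. -/
theorem SRFFContBias_holds : SRFFContBias := by
  intro N
  unfold contBias
  have h2 : (0 : ℝ) < 2 ^ N := by positivity
  have hI : ∀ n ∈ range (2 ^ N),
      ∫ x in (0 : ℝ)..1, (if RSRFF N x n then (1 : ℝ) else 0) = (n : ℝ) / 2 ^ N := by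
    intro n hn
    have hn' : (n : ℝ) < 2 ^ N := by exact_mod_cast mem_range.1 hn
    have e : (fun x : ℝ => if RSRFF N x n then (1 : ℝ) else 0)
        = fun x => if 1 ≤ x + (n : ℝ) / 2 ^ N then (1 : ℝ) else 0 := by
      funext x; exact if_congr Iff.rfl rfl rfl
    rw [e]
    exact integral_ite_one_le_add _ (by positivity) (by rw [div_lt_one h2]; exact hn')
  rw [sum_congr rfl hI, ← sum_div, sum_range_natCast]
  push_cast
  field_simp
  ring

/-- **§III-D / App. A-B** (DISCHARGED): `bias_SRF = 0` over residuals uniform on `[0,1)`: word `n`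
rounds away on `[1 − (n+½)2^{-N}, 1]`. -/
theorem SRFContBias_holds : SRFContBias := by
  intro N
  unfold contBias
  have h2 : (0 : ℝ) < 2 ^ N := by positivity
  have hI : ∀ n ∈ range (2 ^ N),
      ∫ x in (0 : ℝ)..1, (if RSRF N x n then (1 : ℝ) else 0) = ((n : ℝ) + 1 / 2) / 2 ^ N := by
    intro n hn
    have hn' : (n : ℝ) + 1 ≤ 2 ^ N := by exact_mod_cast mem_range.1 hn
    have e : (fun x : ℝ => if RSRF N x n then (1 : ℝ) else 0)
        = fun x => if 1 ≤ x + ((n : ℝ) + 1 / 2) / 2 ^ N then (1 : ℝ) else 0 := by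
      funext x; exact if_congr Iff.rfl rfl rfl
    rw [e]
    exact integral_ite_one_le_add _ (by positivity) (by rw [div_lt_one h2]; linarith)
  rw [sum_congr rfl hI, ← sum_div, sum_add_distrib, sum_range_natCast, sum_const, card_range,
    nsmul_eq_mul]
  push_cast
  field_simp
  ring

/-! ### Completions and caveats not in the paper -/

/-- For `D ≤ N` SRFF resolves every grid input: `bias_{SRFF,D} = 0`. -/
theorem srff_gridBias_of_le {N D : ℕ} (hDN : D ≤ N) : gridBias (RSRFF (K := K) N) N D = 0 := by
  rw [gridBias_rsrff]; exact gridAvg_probAwayA_of_le hDN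

/-- For `D ≤ N`: `bias_{SRF,D} = 0` (so App. A-D's value `2^{-(D+1)}` needs `N < D`, not `N ≤ D`). -/
theorem srf_gridBias_of_le {N D : ℕ} (hDN : D ≤ N) : gridBias (RSRF (K := K) N) N D = 0 := by
  rw [gridBias_rsrf]; exact gridAvg_probAwayB_of_le hDN

/-- For `D ≤ N`: `bias_{SRC,D} = 0`. -/
theorem src_gridBias_of_le {N D : ℕ} (hDN : D ≤ N) :
    gridBias (RSRC (K := K) (fun y => rnite y) N) N D = 0 := by
  rw [gridBias_rsrc]; exact gridAvg_probAwayC_of_le hDN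

/-- **`1 ≤ N` is necessary in §III-F**: with zero random bits SRC is deterministic
round-to-nearest-even, whose grid bias is `−2^{-(D+1)}` for every `D ≥ 1`. -/
theorem src_gridBias_zero_bits {D : ℕ} (hD : 1 ≤ D) :
    gridBias (RSRC (K := K) (fun y => rnite y) 0) 0 D = -(1 / 2 ^ (D + 1)) := by
  rw [gridBias_rsrc]; exact gridAvg_probAwayC_zero_bits hD

/-- **Ties-away pre-rounding does not correct SRFF**: `bias_{SRC∘round,D} = 2^{-(D+1)}` for
`N < D` (it is SRF). -/
theorem srcRound_gridBias {N D : ℕ} (hND : N < D) :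
    gridBias (RSRC (K := K) round N) N D = 1 / 2 ^ (D + 1) := by
  rw [gridBias_rsrc_round, gridBias_rsrf]; exact gridAvg_probAwayB hND

/-! ### Kernel spot-checks over `ℚ` (the definitions compute; independent of the proofs) -/

/-- `D = 5`, `N = 3` (BFloat16 → a precision-3 format, the paper's Fig. 2 setting up to the
number of bits): `bias_{SRFF,5} = (2^{-5} − 2^{-3})/2 = −3/64 = −0.046875`,
`bias_{SRF,5} = 2^{-6} = 0.015625`, `bias_{SRC,5} = 0` — the three values printed in Fig. 2. -/
theorem fig2_values :
    gridBias (RSRFF (K := ℚ) 3) 3 5 = -3 / 64 ∧ gridBias (RSRF (K := ℚ) 3) 3 5 = 1 / 64 ∧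
      gridBias (RSRC (K := ℚ) (fun y => rnite y) 3) 3 5 = 0 := by
  refine ⟨?_, ?_, ?_⟩
  · rw [gridBias_rsrff, gridAvg_probAwayA (by norm_num)]; norm_num
  · rw [gridBias_rsrf, gridAvg_probAwayB (by norm_num)]; norm_num
  · exact src_gridBias_eq_zero 5 (by norm_num)

/-- Raw evaluation of the typed definitions on a small grid (`N = 2`, `D = 3`), independent of
the theorems above: `bias_{SRFF,3} = −2^{-4}`, `bias_{SRF,3} = 2^{-4}`, `bias_{SRC,3} = 0`. -/
theorem smallGrid_eval :
    gridBias (RSRFF (K := ℚ) 2) 2 3 = -1 / 16 ∧ gridBias (RSRF (K := ℚ) 2) 2 3 = 1 / 16 ∧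
      gridBias (RSRC (K := ℚ) (fun y => rnite y) 2) 2 3 = 0 := by
  refine ⟨?_, ?_, ?_⟩ <;>
  · simp only [gridBias, pointBias]
    norm_num [RSRFF, RSRF, RSRC, rnite, Int.odd_iff, Finset.sum_range_succ, -Finset.sum_boole]

end Summit.Ventures.CertifiedArithmetic.LowPrec.SR.LimitedBits
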